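import Mathlib

/-!
# SoloBlind — two-constants assembly (kernel #174, s83; B12′ certificate glue)

The two-constants theorem (Ransford, *Potential theory in the complex plane*, Thm 4.3.7) gives, for a
subharmonic `u = log N₂` on the slit rectangle, `u(x) ≤ (1 - ω) log ε + ω log A` with `ω = ω(x)` the harmonic
measure of the outer boundary.  The certificate only knows an UPPER bound `ω ≤ ω₀` (comparison function) and
the two constants `ε ≤ A` (slit bound, edge bound).  This file is the elementary real-analysis step turning that
into the usable bound `N₂(x) ≤ ε · (A / ε) ^ ω₀`, plus the monotonicity facts the interval evaluation needs.
-/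

namespace Summit.AnomalousDissipation.AnomalousDissipation.Theorems

/-- Convexity bookkeeping: `(1 - ω) log ε + ω log A = log ε + ω (log A - log ε)`. -/
theorem soloBlind_twoConst_rewrite (ω lε lA : ℝ) :
    (1 - ω) * lε + ω * lA = lε + ω * (lA - lε) := by ring

/-- If `u ≤ (1 - ω) log ε + ω log A` with `ω ≤ ω₀` and `0 < ε ≤ A`, then `exp u ≤ ε * (A / ε) ^ ω₀`. -/
theorem soloBlind_twoConst_assembly (u ω ω₀ ε A : ℝ) (hε : 0 < ε) (hεA : ε ≤ A) (hω : ω ≤ ω₀)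
    (hu : u ≤ (1 - ω) * Real.log ε + ω * Real.log A) :
    Real.exp u ≤ ε * (A / ε) ^ ω₀ := by
  have hA : 0 < A := lt_of_lt_of_le hε hεA
  have hlog : 0 ≤ Real.log A - Real.log ε := by
    rw [sub_nonneg]; exact Real.log_le_log hε hεA
  have h1 : u ≤ Real.log ε + ω₀ * (Real.log A - Real.log ε) := by
    rw [soloBlind_twoConst_rewrite] at hu
    exact le_trans hu (by nlinarith)
  have h2 : Real.exp (Real.log ε + ω₀ * (Real.log A - Real.log ε)) = ε * (A / ε) ^ ω₀ := by
    rw [Real.exp_add, Real.exp_log hε, ← Real.log_div hA.ne' hε.ne',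
      Real.rpow_def_of_pos (div_pos hA hε), mul_comm ω₀]
  calc Real.exp u ≤ Real.exp (Real.log ε + ω₀ * (Real.log A - Real.log ε)) := Real.exp_le_exp.mpr h1
    _ = ε * (A / ε) ^ ω₀ := h2

/-- Monotonicity in the data: the bound `ε (A/ε)^ω₀ = ε^(1-ω₀) A^ω₀` increases with `A` (for `0 ≤ ω₀`). -/
theorem soloBlind_twoConst_mono_A (ε A A' ω₀ : ℝ) (hε : 0 < ε) (hA : 0 ≤ A) (hAA' : A ≤ A') (hω0 : 0 ≤ ω₀) :
    ε * (A / ε) ^ ω₀ ≤ ε * (A' / ε) ^ ω₀ := by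
  have h : (A / ε) ^ ω₀ ≤ (A' / ε) ^ ω₀ :=
    Real.rpow_le_rpow (div_nonneg hA hε.le) (div_le_div_of_nonneg_right hAA' hε.le) hω0
  exact mul_le_mul_of_nonneg_left h hε.le

/-- The resonance step: if `N₂(x) ≤ ε (A/ε)^ω₀ =: b` and `b < g ≤ |1 - t₁(x)|` then the quadratic resolvent bound
`(1 + m + |t₁|) / (|1 - t₁| - N₂)` is at most `(1 + m + |t₁|) / (g - b)` (monotone in the denominator). -/
theorem soloBlind_twoConst_resonance (N b g d m τ : ℝ) (hN : N ≤ b) (hbg : b < g) (hgd : g ≤ d) (hm : 0 ≤ m)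
    (hτ : 0 ≤ τ) :
    (1 + m + τ) / (d - N) ≤ (1 + m + τ) / (g - b) := by
  have hgb : 0 < g - b := by linarith
  have hle : g - b ≤ d - N := by linarith
  exact div_le_div_of_nonneg_left (by positivity) hgb hle

end Summit.AnomalousDissipation.AnomalousDissipation.Theorems
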